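import Summits.CriticalPhenomena.PercolationContinuityZ3.Theorems.Transplant.FKConnectivityAllQPat3SymCone
import Summits.CriticalPhenomena.PercolationContinuityZ3.Theorems.Transplant.FKConnectivityAllQPat3ThetaGluing
import Summits.CriticalPhenomena.PercolationContinuityZ3.Theorems.Transplant.FKConnectivityAllQPat3RingGluing
import HarnessLib

/-!
# Connectivity correlation inequalities for `φ_{w,q}`, every `q > 0` — THETA AND RING GRAPHS: a product-cone certificate
# (entrywise or symmetrised) gives levelwise nonnegativity of the target (Stage S2, part 2d — everything but the data)

Theorems file (`--supports stmt-CriticalPhenomena-4575`), census lane `prim-bschramm-census` (gen 36) of the post-continuity programme (LANE 2 bschramm, FK sub-lane);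
builds on p205010 (kernel theorem, internal audit signed; external expert review pending).
No definitions, no named facts, no sorries; standard axioms.  `FK.corr3_le_two`, `FK.corrRing_le_two` (by `decide`);
**`FK.theta_level_nonneg_of_cert`** / **`FK.ring_level_nonneg_of_cert`** (`FK.cone3_level_nonneg` instantiated with
`FK.tval_union3_theta` / `FK.tval_union3_ring`) and **`FK.theta_level_nonneg_of_symCert`** / **`FK.ring_level_nonneg_of_symCert`**
(`FK.cone3_level_nonneg_sym`, the form census g34's certificates have: `8 · Σ_j λ_j π_j ≤ D · FK.target3Sym`): for three
two-terminal pieces with inner marks in the THETA / RING configuration of census g34's Lemma Θ₃, a finite family of products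
dominated by the (symmetrised) target whose generators are levelwise nonnegative on their pieces yields
`0 ≤ D · lev2 (E_K ∪ E₁ ∪ E₂) b s t T λ` at every level.  The certificate family comes from `FK.cert_of_pairs` /
`FK.symCert_of_pairs` (file `…Pat3FastCheck.lean`, 25 `decide +kernel` declarations per certificate) or `FK.certCheck3_spec`;
the validity family from the generator dictionary (file `…Pat3GenDict.lean`).  What THEOREM SP on THETA/RING graphs still needs in
the kernel: the four data files (census g34's THETA_TS 111 / THETA_STAR 191 / RING_TS 245 / RING_STAR 157 products re-derived in
ordered pattern coordinates — census g36's `out/tables.json` + memo §12).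
[cite: AyyerLinussonRavichandran2025, §7 eq. (13)–(15) (p. 22)] [cite: Grimmett2006, §3.8 (pp. 61–62)]
-/

noncomputable section

namespace Summit.CriticalPhenomena.PercolationContinuityZ3.Theorems

namespace FK

open SimpleGraph Literature.Probability.LatticeModels Literature.Probability.Percolation

/-! ### Level corrections are at most two -/

/-- The THETA correction is at most `2`. [folklore] -/
theorem corr3_le_two : ∀ P1 P2 P3 : Pat3, corr3 P1 P2 P3 ≤ 2 := by decide

/-- The RING correction is at most `2`. [folklore] -/
theorem corrRing_le_two : ∀ P1 P2 P3 : Pat3, corrRing P1 P2 P3 ≤ 2 := by decide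

/-! ### THETA and RING graphs: certificates give levelwise nonnegativity -/

section Graphs

open scoped Classical

variable {V : Type*} [Fintype V]

/-- **THETA graphs: an entrywise product-cone certificate gives levelwise nonnegativity.**  For three two-terminal pieces `E_K ∋ b`,
`E₁ ∋ s`, `E₂ ∋ t` glued in parallel between the corners `u, v` (edge-disjoint, edges on `V_K, V₁, V₂` pairwise meeting inside
`{u, v}`, marks off the other pieces and off the corners), a two-level target `T`, a finite family of products whose tensors are
dominated entrywise by `D · τ_T` (`hcert` — e.g. from `FK.certCheck3_spec` or `FK.cert_of_pairs`) and whose generators are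
levelwise nonnegative on their pieces (positional coordinates `(u, v, mark)`): `0 ≤ D · lev2 (E_K ∪ E₁ ∪ E₂) b s t T λ` at every
level. [cite: AyyerLinussonRavichandran2025, §7 (p. 22)] -/
theorem theta_level_nonneg_of_cert {EK E₁ E₂ : Finset (Sym2 V)} {VK V₁ V₂ : Set V} {u v b s t : V}
    (hdK1 : Disjoint EK E₁) (hdK2 : Disjoint EK E₂) (hd12 : Disjoint E₁ E₂)
    (hK : ∀ e ∈ (↑EK : Set (Sym2 V)), ∀ z ∈ e, z ∈ VK)
    (h₁ : ∀ e ∈ (↑E₁ : Set (Sym2 V)), ∀ z ∈ e, z ∈ V₁) (h₂ : ∀ e ∈ (↑E₂ : Set (Sym2 V)), ∀ z ∈ e, z ∈ V₂)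
    (hK1 : VK ∩ V₁ ⊆ ({u, v} : Set V)) (hK2 : VK ∩ V₂ ⊆ ({u, v} : Set V)) (h12 : V₁ ∩ V₂ ⊆ ({u, v} : Set V)) (huv : u ≠ v)
    (hb1 : b ∉ V₁) (hb2 : b ∉ V₂) (hsK : s ∉ VK) (hs2 : s ∉ V₂) (htK : t ∉ VK) (ht1 : t ∉ V₁)
    (hbu : b ≠ u) (hbv : b ≠ v) (hsu : s ≠ u) (hsv : s ≠ v) (htu : t ≠ u) (htv : t ≠ v)
    (hbs : b ≠ s) (hbt : b ≠ t) (hst : s ≠ t)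
    (T : ℕ → Pat3 → Pat3 → ℤ) (D : ℕ) {ι : Type*} (J : Finset ι) (prod : ι → Prod3)
    (hcert : ∀ d : ℕ, ∀ PK QK P1 Q1 P2 Q2 : Pat3,
      ∑ j ∈ J, ((prod j).lam : ℤ) * (prod j).tensor d PK QK P1 Q1 P2 Q2 ≤ D * target3 join3 corr3 T d PK QK P1 Q1 P2 Q2)
    (hval : ∀ j ∈ J, ∀ μ : ℕ, 0 ≤ lev2 EK u v b (prod j).gK μ ∧ 0 ≤ lev2 E₁ u v s (prod j).g1 μ ∧ 0 ≤ lev2 E₂ u v t (prod j).g2 μ)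
    (lam : ℕ) : 0 ≤ (D : ℤ) * lev2 (EK ∪ E₁ ∪ E₂) b s t T lam :=
  cone3_level_nonneg join3 corr3 (4 * Fintype.card V)
    (fun wt tab => tval_union3_theta hdK1 hdK2 hd12 hK h₁ h₂ hK1 hK2 h12 huv hb1 hb2 hsK hs2 htK ht1 hbu hbv hsu hsv htu htv hbs hbt hst wt tab)
    T D J prod hcert hval lam

/-- **THETA graphs, symmetrised certificate** (the form census g34's THETA_TS / THETA_STAR certificates have: domination after
summing over the flip orbit, `FK.cone3_level_nonneg_sym`; `hcert` e.g. from `FK.symCert_of_pairs`).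
[cite: AyyerLinussonRavichandran2025, §7 (p. 22)] -/
theorem theta_level_nonneg_of_symCert {EK E₁ E₂ : Finset (Sym2 V)} {VK V₁ V₂ : Set V} {u v b s t : V}
    (hdK1 : Disjoint EK E₁) (hdK2 : Disjoint EK E₂) (hd12 : Disjoint E₁ E₂)
    (hK : ∀ e ∈ (↑EK : Set (Sym2 V)), ∀ z ∈ e, z ∈ VK)
    (h₁ : ∀ e ∈ (↑E₁ : Set (Sym2 V)), ∀ z ∈ e, z ∈ V₁) (h₂ : ∀ e ∈ (↑E₂ : Set (Sym2 V)), ∀ z ∈ e, z ∈ V₂)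
    (hK1 : VK ∩ V₁ ⊆ ({u, v} : Set V)) (hK2 : VK ∩ V₂ ⊆ ({u, v} : Set V)) (h12 : V₁ ∩ V₂ ⊆ ({u, v} : Set V)) (huv : u ≠ v)
    (hb1 : b ∉ V₁) (hb2 : b ∉ V₂) (hsK : s ∉ VK) (hs2 : s ∉ V₂) (htK : t ∉ VK) (ht1 : t ∉ V₁)
    (hbu : b ≠ u) (hbv : b ≠ v) (hsu : s ≠ u) (hsv : s ≠ v) (htu : t ≠ u) (htv : t ≠ v)
    (hbs : b ≠ s) (hbt : b ≠ t) (hst : s ≠ t)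
    (T : ℕ → Pat3 → Pat3 → ℤ) (D : ℕ) {ι : Type*} (J : Finset ι) (prod : ι → Prod3)
    (hcert : ∀ d : ℕ, ∀ PK QK P1 Q1 P2 Q2 : Pat3,
      8 * ∑ j ∈ J, ((prod j).lam : ℤ) * (prod j).tensor d PK QK P1 Q1 P2 Q2 ≤ D * target3Sym join3 corr3 T d PK QK P1 Q1 P2 Q2)
    (hval : ∀ j ∈ J, ∀ μ : ℕ, 0 ≤ lev2 EK u v b (prod j).gK μ ∧ 0 ≤ lev2 E₁ u v s (prod j).g1 μ ∧ 0 ≤ lev2 E₂ u v t (prod j).g2 μ)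
    (lam : ℕ) : 0 ≤ (D : ℤ) * lev2 (EK ∪ E₁ ∪ E₂) b s t T lam :=
  cone3_level_nonneg_sym join3 corr3 (4 * Fintype.card V)
    (fun wt tab => tval_union3_theta hdK1 hdK2 hd12 hK h₁ h₂ hK1 hK2 h12 huv hb1 hb2 hsK hs2 htK ht1 hbu hbv hsu hsv htu htv hbs hbt hst wt tab)
    T D J prod hcert hval lam

/-- **RING graphs: an entrywise product-cone certificate gives levelwise nonnegativity** (the ring `K(v,u;b)·Q₁(u,w;s)·Q₂(w,v;t)`;
generators in the pieces' coordinates `(v,u,b)`, `(u,w,s)`, `(w,v,t)`). [cite: AyyerLinussonRavichandran2025, §7 (p. 22)] -/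
theorem ring_level_nonneg_of_cert {EK E₁ E₂ : Finset (Sym2 V)} {VK V₁ V₂ : Set V} {u v w b s t : V}
    (hdK1 : Disjoint EK E₁) (hdK2 : Disjoint EK E₂) (hd12 : Disjoint E₁ E₂)
    (hK : ∀ e ∈ (↑EK : Set (Sym2 V)), ∀ z ∈ e, z ∈ VK)
    (h₁ : ∀ e ∈ (↑E₁ : Set (Sym2 V)), ∀ z ∈ e, z ∈ V₁) (h₂ : ∀ e ∈ (↑E₂ : Set (Sym2 V)), ∀ z ∈ e, z ∈ V₂)
    (hK1 : VK ∩ V₁ ⊆ ({u} : Set V)) (h12 : V₁ ∩ V₂ ⊆ ({w} : Set V)) (hK2 : VK ∩ V₂ ⊆ ({v} : Set V))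
    (hu2 : u ∉ V₂) (hv1 : v ∉ V₁) (huv : u ≠ v) (huw : u ≠ w) (hvw : v ≠ w)
    (hb1 : b ∉ V₁) (hb2 : b ∉ V₂) (hsK : s ∉ VK) (hs2 : s ∉ V₂) (htK : t ∉ VK) (ht1 : t ∉ V₁)
    (hbu : b ≠ u) (hbv : b ≠ v) (hsu : s ≠ u) (hsv : s ≠ v) (hsw : s ≠ w) (htu : t ≠ u) (htv : t ≠ v) (htw : t ≠ w)
    (hbs : b ≠ s) (hbt : b ≠ t) (hst : s ≠ t)
    (T : ℕ → Pat3 → Pat3 → ℤ) (D : ℕ) {ι : Type*} (J : Finset ι) (prod : ι → Prod3)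
    (hcert : ∀ d : ℕ, ∀ PK QK P1 Q1 P2 Q2 : Pat3,
      ∑ j ∈ J, ((prod j).lam : ℤ) * (prod j).tensor d PK QK P1 Q1 P2 Q2 ≤ D * target3 joinRing corrRing T d PK QK P1 Q1 P2 Q2)
    (hval : ∀ j ∈ J, ∀ μ : ℕ, 0 ≤ lev2 EK v u b (prod j).gK μ ∧ 0 ≤ lev2 E₁ u w s (prod j).g1 μ ∧ 0 ≤ lev2 E₂ w v t (prod j).g2 μ)
    (lam : ℕ) : 0 ≤ (D : ℤ) * lev2 (EK ∪ E₁ ∪ E₂) b s t T lam :=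
  cone3_level_nonneg joinRing corrRing (4 * Fintype.card V)
    (fun wt tab => tval_union3_ring hdK1 hdK2 hd12 hK h₁ h₂ hK1 h12 hK2 hu2 hv1 huv huw hvw hb1 hb2 hsK hs2 htK ht1 hbu hbv hsu hsv hsw htu htv htw hbs hbt hst wt tab)
    T D J prod hcert hval lam

/-- **RING graphs, symmetrised certificate** (census g34's RING_TS / RING_STAR form). [cite: AyyerLinussonRavichandran2025, §7 (p. 22)] -/
theorem ring_level_nonneg_of_symCert {EK E₁ E₂ : Finset (Sym2 V)} {VK V₁ V₂ : Set V} {u v w b s t : V}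
    (hdK1 : Disjoint EK E₁) (hdK2 : Disjoint EK E₂) (hd12 : Disjoint E₁ E₂)
    (hK : ∀ e ∈ (↑EK : Set (Sym2 V)), ∀ z ∈ e, z ∈ VK)
    (h₁ : ∀ e ∈ (↑E₁ : Set (Sym2 V)), ∀ z ∈ e, z ∈ V₁) (h₂ : ∀ e ∈ (↑E₂ : Set (Sym2 V)), ∀ z ∈ e, z ∈ V₂)
    (hK1 : VK ∩ V₁ ⊆ ({u} : Set V)) (h12 : V₁ ∩ V₂ ⊆ ({w} : Set V)) (hK2 : VK ∩ V₂ ⊆ ({v} : Set V))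
    (hu2 : u ∉ V₂) (hv1 : v ∉ V₁) (huv : u ≠ v) (huw : u ≠ w) (hvw : v ≠ w)
    (hb1 : b ∉ V₁) (hb2 : b ∉ V₂) (hsK : s ∉ VK) (hs2 : s ∉ V₂) (htK : t ∉ VK) (ht1 : t ∉ V₁)
    (hbu : b ≠ u) (hbv : b ≠ v) (hsu : s ≠ u) (hsv : s ≠ v) (hsw : s ≠ w) (htu : t ≠ u) (htv : t ≠ v) (htw : t ≠ w)
    (hbs : b ≠ s) (hbt : b ≠ t) (hst : s ≠ t)
    (T : ℕ → Pat3 → Pat3 → ℤ) (D : ℕ) {ι : Type*} (J : Finset ι) (prod : ι → Prod3)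
    (hcert : ∀ d : ℕ, ∀ PK QK P1 Q1 P2 Q2 : Pat3,
      8 * ∑ j ∈ J, ((prod j).lam : ℤ) * (prod j).tensor d PK QK P1 Q1 P2 Q2 ≤ D * target3Sym joinRing corrRing T d PK QK P1 Q1 P2 Q2)
    (hval : ∀ j ∈ J, ∀ μ : ℕ, 0 ≤ lev2 EK v u b (prod j).gK μ ∧ 0 ≤ lev2 E₁ u w s (prod j).g1 μ ∧ 0 ≤ lev2 E₂ w v t (prod j).g2 μ)
    (lam : ℕ) : 0 ≤ (D : ℤ) * lev2 (EK ∪ E₁ ∪ E₂) b s t T lam :=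
  cone3_level_nonneg_sym joinRing corrRing (4 * Fintype.card V)
    (fun wt tab => tval_union3_ring hdK1 hdK2 hd12 hK h₁ h₂ hK1 h12 hK2 hu2 hv1 huv huw hvw hb1 hb2 hsK hs2 htK ht1 hbu hbv hsu hsv hsw htu htv htw hbs hbt hst wt tab)
    T D J prod hcert hval lam

end Graphs

end FK

end Summit.CriticalPhenomena.PercolationContinuityZ3.Theorems

end
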